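import Mathlib
import HarnessLib
import HarnessLib.Audit
import Summits.AtomisticToContinuum.Statement
import Literature.MathematicalPhysics.QuantumManyBody.PeriodicBoseGasFourier
import Literature.MathematicalPhysics.QuantumManyBody.PeriodicBoseGasLocalization
import HarnessLib.Audit.Status.Attr

/-!
Route: BECPhaseQuadratureSumRule

DORMANT since 2026-08-25T01:45:05Z (reconciler: no traction for 7.3 d (last activity item-evidence-added at 2026-08-17T18:55:01Z); parked, not closed — `ledger route dormant route-AtomisticToContinuum-BECPhaseQuadratureSumRule --off` to) — unstaffed, not closed; items shared with open routes are served there. `ledger route dormant <id> --off` reactivates.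

# Route BECPhaseQuadratureSumRule — phase-quadrature sum rule (m₂² ≤ m₁m₃ on the current) + c-number
split + coupling bootstrap from the free gas

It suffices to show X = SmoothPeriodicBEC ∧ BoundaryTransferWeak ∧ ScatteringLengthTransfer ∧
SmoothPartner. SmoothPeriodicBEC (target):
constant-mode BEC for near-minimisers of the PERIODIC N-body energy on the torus of side (N/ρ)^(1/3)
at all small ρ, for every finite C²
finite-range repulsive potential with the edge condition ‖D²ṽ‖ ≤ Cₑ√ṽ; it is reduced by the glue
item SumRuleChainGlue to three cruxes on
the torus minimiser Ψ_t of −Σ∆ + tΣv^per, uniformly in t ∈ (0,1] — NonCondensateRemainders (summed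
4-point remainders of the c-number split
of the longitudinal current [H,ρ_k†] and of ρ_k† over the infrared modes |k| < Λ√(ρa) are o(N²)),
CondensateNumberConcentration
(Var N̂₀ = o(N²)) and LongWaveStructureBound (box-number second moments) — plus four fixed-N
supports. BoundaryTransferWeak (shared item
stmt-0827) carries torus BEC to the Dirichlet criterion; ScatteringLengthTransfer (shared item
stmt-4285) with the provable support
SmoothPartner carries the smooth class to every repulsive finite-range potential, hard cores
included. This is the D-0027 §2.1-conforming
re-opening of route BECSumRuleBootstrap (retired not-a-thesis: its assembly named the Literature
constant): `closes` concludes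
`_root_.BoseEinsteinCondensation`. Card realised: diamagnetic-gd-bootstrap (retitled per its five
audits: the longitudinal "diamagnetic
Gaussian domination" is B_k = N by the f-sum rule; the engine is m₂² ≤ m₁m₃).
Lean: `(open Literature.MathematicalPhysics.QuantumManyBody.BoseGas in ∀ v : ℝ → ENNReal,
IsRepulsiveFiniteRange v → (∀ r, v r ≠ ⊤) → ContDiff ℝ 2 (fun x : Space => (v ‖x‖).toReal) → (∃ Cₑ :
ℝ, ∀ x : Space, ‖iteratedFDeriv ℝ 2 (fun x : Space => (v ‖x‖).toReal) x‖ ≤ Cₑ * Real.sqrt ((v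
‖x‖).toReal)) → ∃ ρ₀ : ℝ, 0 < ρ₀ ∧ ∀ ρ : ℝ, 0 < ρ → ρ < ρ₀ → ∃ c : ℝ, 0 < c ∧ ∀ᶠ N : ℕ in
Filter.atTop, ∃ δ : ENNReal, 0 < δ ∧ ∀ Ψ : PeriodicTrialState N (sideLength ρ N), periodicEnergy v Ψ
≤ periodicGroundStateEnergy v N (sideLength ρ N) + δ → ENNReal.ofReal (c * N) ≤ condensateOccupation
N (sideLength ρ N) Ψ.ψ) ∧ BoundaryTransferWeak ∧ ScatteringLengthTransfer ∧ SmoothPartner`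

## Assembly
Pure logic, certified in glue.lean (theorem closes, sorry-free, axioms
propext/Classical.choice/Quot.sound; lean check rc 0 on
Sketch.lean): fix w repulsive finite-range; SmoothPartner gives a bounded smooth-class v with
scatteringLength v = scatteringLength w;
SumRuleChainGlue fed with the four supports and the three torus cruxes yields SmoothPeriodicBEC,
whose instance at v is exactly the
hypothesis of BoundaryTransferWeak v, giving ∃ρ₀ ∀ρ∈(0,ρ₀) HasGroundStateBEC v ρ;
ScatteringLengthTransfer v w turns it into the same
for w, i.e. the body of `_root_.BoseEinsteinCondensation` (the sub-problem Statement decl BY NAME,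
D-0027 §2.1). The deciding theorem is
`closes : SmoothPeriodicBEC → NonCondensateRemainders → CondensateNumberConcentration →
LongWaveStructureBound → BoundaryTransferWeak → ScatteringLengthTransfer → CurrentSumRule →
MinimiserRegularity → NearMinimiserStability → CouplingContinuity → SumRuleChainGlue → SmoothPartner
→ Assembly → _root_.BoseEinsteinCondensation`
(the Assembly hypothesis is not used by the proof term; Assembly itself is the same implication
without it, pure logic).

Rationale: WHY THIS LINE. The only proofs of BEC for interacting bosons in a thermodynamic limit
(DysonLiebSimon1978, KLS1988PRL) run Gaussian domination ⇒
infrared bound ⇒ sum rule; here the domination is an EXACT ground-state inequality of the sum-rule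
school (Puff1965, Wagner1966,
PitaevskiiStringari1991, Stringari1995 §2.3 eqs. (19)–(23)): for the torus minimiser the
longitudinal current A_k = [H,ρ_k†] has
m₂ = ‖A_kΨ‖² ≤ 2√(m₁M₃) with m₁ = N|k|² (f-sum) and M₃ ≤ N|k|⁴(|k|² + O(ρa) + O(ρ^(1/4))) (cubic sum
rule; momentum conservation kills the
|k|⁰ term) — Bogoliubov-sharp for the PHASE quadrature and an upper bound, whereas the printed uses
(Stringari1995 (9)–(11), (17), (23);
Leggett doi:10.1088/1367-2630/3/1/323) are lower bounds on n(q), upper bounds on ω₀(q) or UPPER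
bounds on n₀. The c-number split
(LiebSeiringerYngvason2005) gives the exact per-mode identity ‖A_k^cΨ‖²/|k|⁴ + ‖ρ_k^(c†)Ψ‖² = 2n₀ +
2E[N̂₀(n̂_k+n̂_−k)] + 2n_−k; summing over
|k| < Λ√(ρa) (mode count Λ³√(ρa³)N ≪ N) and cutting the UV by kinetic energy ≤ E₀ ≤ 8πaρN (LSSY2005
Thm 2.2, proved in tree) yields the
dichotomy E[N̂₀(N−N̂₀)] ≤ εN², whence x = n₀/N obeys x(1−x) ≤ ε + Var(N̂₀)/N², and the forbidden
band is crossed from x(0) = 1 by continuity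
in the coupling at fixed N, L (Kato1966). Imported: sum rules / linear response (many-body physics),
convexity + Fournais2020's localized
lower bound (proved in tree) for the long-wave variance, analytic perturbation theory; no RP, no gap
at scale L, no matching of energy
asymptotics. Versus the retired BECSumRuleBootstrap: conforming `closes`; CurrentSumRule stated with
the factor 4 that needs no inversion
symmetry or ground-state uniqueness; the untouchable HardCoreExtension replaced by the shared
universality crux ScatteringLengthTransfer
plus the provable SmoothPartner. The negatives index (6 entries, one BEC: SwapJensen) is not touched
by any item.

RANKED CRUXES. #0 SmoothPeriodicBEC (target) — PeriodicBEC restricted to the smooth class: for every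
repulsive finite-range v that is finite, C² as ṽ(x) = v(|x|) on ℝ³, with ‖D²ṽ(x)‖ ≤ Cₑ√ṽ(x) (e.g.
(R₀²−|x|²)₊⁴), there is ρ₀ > 0 such that for 0 < ρ < ρ₀ there is c > 0 with: for all large N there
is δ > 0 such that every periodic trial state on the torus of side (N/ρ)^(1/3) with periodicEnergy ≤
E₀^per + δ has constant-mode occupation ≥ cN. (why it might fail: contains the open
thermodynamic-limit BEC problem for smooth potentials (LSSY2005 Ch. 5;
Fournais2020/Junge2026/ChongLiangNam2026 stop at L ≲ a(ρa³)^(−3/4−η)).) [LSSY2005, Fournais2020,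
Junge2026, ChongLiangNam2026]
#2 NonCondensateRemainders (crux) — (card C1, corrected and summed) for the torus minimiser Ψ of
−Σ∆ⱼ + tΣv^per (t ∈ (0,1], L = (N/ρ)^(1/3), ρ < ρ₀(Λ,ε), N large): Σ over 0 < |k| < Λ√(ρa), k =
2πn/L, of ‖A_k^(nc)Ψ‖²/|k|⁴ + ‖ρ_k^(nc†)Ψ‖² is ≤ εN², where A_k^(nc) = Σⱼ Qⱼe^(ik·xⱼ)(−2ik·∇ⱼ +
|k|²)Qⱼ and ρ_k^(nc†) = Σⱼ Qⱼe^(ik·xⱼ)Qⱼ (Q = 1 − |φ₀⟩⟨φ₀|, written with cell averages) are the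
non-condensate parts of the longitudinal current [H,ρ_k†] and of the density. Bogoliubov:
O(|k|⁴N√(ρa³)) resp. O(N√(ρa³)) per mode (pair currents (u_pv_q − v_pu_q)² cancel at k = 0), summed
O(Λ³ρa³N²) — no log. [difficulty: open-problem] (why it might fail: 4-point functions of the
depletion with no a-priori handle (Cauchy–Schwarz gives N₊|k|²⟨T⟩, useless); smallness rests on
Bogoliubov's pair-current cancellation, unproved for Ψ₀ (Gavoret–Nozières territory); a log L in the
current remainder already breaks ε.) [LiebSeiringerYngvason2005, Stringari1995, GavoretNozieres1964,
Griffin1993, Literature.Barriers.AtomisticToContinuum.BogoliubovPerturbationInfrared]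
#3 CondensateNumberConcentration (crux) — along the coupling path the zero-mode number N̂₀ = ΣⱼPⱼ of
the torus minimiser satisfies E[N̂₀²] = N(N−1)‖P₁P₂Ψ‖² + n₀ ≤ n₀² + ζN² for N large, every ζ > 0, ρ
< ρ₀(ζ), uniformly in t ∈ (0,1] (Var(N̂₀/N) → 0); with the chain's dichotomy E[N̂₀(N−N̂₀)] ≤ εN²
this gives x(1−x) ≤ ε + ζ for x = n₀/N. Bogoliubov: Var N̂₀ = Σ_k 2u_k²v_k² = O(N√(ρa³)).
[difficulty: XL] (why it might fail: equivalent to excluding a macroscopic superposition of a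
condensed and an uncondensed branch (an avoided crossing at some t* ≤ 1 at finite N); reducible to
m₁(N̂₀) = O(Nρ) plus a P=0-sector gap ≫ a/L³, and no N-uniform gap bound is known.)
[GiorginiPitaevskiiStringari1998, LiebSeiringerYngvason2005, LSSY2005,
Literature.Barriers.AtomisticToContinuum.SymmetryBreakingWithoutCondensate]
#4 LongWaveStructureBound (crux) — long-wave number fluctuations of the torus minimiser are
relatively small: with ℓ = (K√(ρa))⁻¹ and periodised sliding boxes Λ_u(ℓ), L⁻³∫_cell E_Ψ[N_(Λ_u)²]
du ≤ (1+ε)(ρℓ³)² for N large, every K, ε > 0, ρ < ρ₀(K,ε), uniformly in t. By Parseval in u it gives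
Σ_(0<|k|<πK√(ρa)) ‖ρ_k†Ψ‖² ≤ (π/2)⁶εN² (all the static-structure input the chain needs) and the
close-pair count E[#{i<j: |xᵢ−xⱼ| < R₀}] ≤ 4(1+ε)Nρℓ³ entering M₃. [difficulty: L] (why it might
fail: meant to follow from convexity: Fournais2020 Thm 2.1 (proved) box-wise on a K-grid vs Dyson's
upper bound at GP parameter ρaℓ² = K⁻²; if the constants are not uniform on the grid or the flat-top
χ boundary layer leaks, it needs an LHY-precision upper bound.) [Fournais2020,
BrietzkeFournaisSolovej2020, LSSY2005, YauYin2009, BastiCenatiempoSchlein2021]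
#5 BoundaryTransferWeak (crux) — (shared verbatim, stmt-AtomisticToContinuum-0827) for each
repulsive finite-range v, PeriodicBEC(v) implies ∃ρ₀>0 ∀ρ∈(0,ρ₀) HasGroundStateBEC v ρ (Dirichlet
ground state, mode-free λ_max(γ) ≥ cN via condensateNumber); expected proof: Neumann bracketing of
interior sub-boxes + λ_max ≥ tr γ²/N. [deps: SmoothPeriodicBEC] [difficulty: L] (why it might fail:
PeriodicBEC(v) is ground-state-only (δ after N); the Dirichlet GS is a periodic trial state but lies
a wall term ≫ δ above E₀^per, so no energy-comparison proof; only the ENERGY transfer is in print;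
BEC can be boundary-condition sensitive.) [LSSY2005, arXiv:2203.01841, arXiv:2205.15284,
doi:10.1007/bf01608554]
#6 ScatteringLengthTransfer (crux) — (shared verbatim with routes EqualScatteringTransfer /
BECChargeConjugationRP, stmt-AtomisticToContinuum-4285) for admissible bounded v and any admissible
w with equal scattering length, small-density Dirichlet BEC transfers from v to w — here it carries
the smooth class (via SmoothPartner) to every repulsive finite-range potential, hard cores, shells
and kinks included; replaces the retired route's HardCoreExtension. [deps: SmoothPeriodicBEC]
[difficulty: XL] (why it might fail: false iff hard- and soft-core gases of equal a differ w.r.t.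
BEC (LSSY2005 Ch. 2 open question, BEC form); implied by the conjunct, so no cheap refutation, but
every proof idea needs an N-uniform corrector/monotonicity bound (none known).) [LSSY2005,
LiebYngvason1998, doi:10.1103/physreva.60.5129,
Literature.Barriers.AtomisticToContinuum.EnergyAsymptoticsWithoutCondensation]
#9 CurrentSumRule (support) — (the engine, variational form, NO symmetry needed) for t ∈ (0,1], 2R₀
< L and every C³ periodic finite-energy minimiser Ψ of −Σ∆ + tΣv^per, for every k = 2πn/L ≠ 0: m₂² ≤
4·m₁·M₃ with m₂ = ‖Σⱼe^(ik·xⱼ)(−2ik·∇ⱼ+|k|²)Ψ‖² (= ‖[H,ρ_k†]Ψ‖²), m₁ = N|k|² and M₃ =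
12|k|²Σⱼ‖(k·∇ⱼ)Ψ‖² + N|k|⁶ + 4E_Ψ[Σ_(i<j)(1−cos k·(xᵢ−xⱼ))|(k·∇)²(tṽ^per)(xᵢ−xⱼ)|]. Proof: q(φ) :=
⟨φ,(H−E₀)φ⟩ ≥ 0 (variational), discriminant of q(sA_kΨ − ρ_k†Ψ) = s²q(A_kΨ) − 2sm₂ + q(ρ_k†Ψ) gives
m₂² ≤ q(A_kΨ)q(ρ_k†Ψ); the double commutators [ρ_k,[H,ρ_k†]] = 2N|k|² and ⟨[A_k†,[H,A_k]]⟩ = 2N|k|⁶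
+ 24|k|²Σ‖(k·∇ⱼ)Ψ‖² + 8E[Σ(1−cos)∂_k²(tṽ)] bound q(ρ_k†Ψ) + q(ρ_−k†Ψ) and q(A_kΨ) + q(A_−kΨ), each
term ≥ 0 — weak Euler–Lagrange equation + integration by parts only, no spectral theorem, no
uniqueness. [difficulty: M] [Puff1965, Wagner1966, Stringari1995, PitaevskiiStringari1991,
KLS1988PRL]
#9 MinimiserRegularity (support) — for every class potential, N ≥ 1 and L > 0 the periodic N-body
energy has a minimiser in the C¹ periodic Bose-symmetric class which is C³ with finite energy
(Rellich on the torus, Schauder C^(3,α) for V ∈ C², bosonic ground state = absolute ground state).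
[difficulty: L] [ReedSimonIV1978, LSSY2005]
#9 NearMinimiserStability (support) — at fixed N, L: for every ε > 0 there is δ > 0 such that every
δ-near-minimiser Φ has condensateOccupation ≥ that of a minimiser Ψ minus εN (discrete spectrum,
simple positive ground state: ‖Φ − e^(iθ)Ψ‖² ≤ δ/gap; n₀ is 2N-Lipschitz in L²). [difficulty: M]
[ReedSimonIV1978, LSSY2005]
#9 CouplingContinuity (support) — at fixed N, L the constant-mode occupation of the minimiser of −Σ∆
+ tΣv^per is uniformly continuous in t ∈ [0,1] (two minimisers at the same t have the same n₀; at t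
= 0 the minimisers are the constants, n₀ = N): analytic perturbation theory of a simple isolated
eigenvalue (free torus gap (2π/L)², Perron–Frobenius for t > 0). [difficulty: L] [Kato1966,
ReedSimonIV1978]
#9 SumRuleChainGlue (support) — (glue of the foreseen split) MinimiserRegularity →
CouplingContinuity → NearMinimiserStability → CurrentSumRule → LongWaveStructureBound →
NonCondensateRemainders → CondensateNumberConcentration → SmoothPeriodicBEC. Bookkeeping: (i)
per-mode identity ‖A_k^cΨ‖²/|k|⁴ + ‖ρ_k^(c†)Ψ‖² = 2n₀ + 2E[N̂₀(n̂_k+n̂_−k)] + 2n_−k and ‖A^c‖ ≤ ‖A‖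
+ ‖A^(nc)‖; (ii) m₂ ≤ 2√(N|k|²M₃), M₃ ≤ N|k|⁴(|k|² + 96πaρ + O(ρ^(1/4))) from Σ‖(k·∇ⱼ)Ψ‖² ≤ |k|²KE ≤
|k|²E₀(tv) ≤ |k|²E₀(v) ≤ |k|²·8πaρN (LSSY2005_upperBound_periodic_holds, scatteringLength_mono) and,
for the potential part, t‖D²ṽ‖ ≤ √t·Cₑ√(tṽ) + Cauchy–Schwarz + close-pair count ≤ 4(1+ε)Nρℓ³; (iii)
Σ_IR ‖ρ_k†Ψ‖² ≤ (π/2)⁶εN² (Parseval in u, K = Λ/π), mode count ≤ Λ³√(ρa³)N/(6π²), Σ_IR 1/|k| =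
L³Λ²ρa/(4π²)(1+o(1)); (iv) UV: Σ_(|k|≥Λ√(ρa)) n_k ≤ KE/(Λ²ρa) ≤ 8πN/Λ² (cell Fourier toolkit
tsum_sq_grad_cellFourierCoeff); (v) ⇒ E[N̂₀(N−N̂₀)] ≤ ε₁N², with crux 3 x(1−x) ≤ ε₁ + ζ < 3/16 ⇒ x ∉
(1/4,3/4) for all t; CouplingContinuity, x(0) = 1 (zero kinetic energy ⇒ constant) and connectedness
of [0,1] ⇒ x(1) ≥ 3/4; NearMinimiserStability with ε = 1/4 ⇒ c = 1/2. Degenerate a = 0: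
LSSY2005_zeroScatteringLength_holds + continuity ⇒ v = 0, minimiser constant. [difficulty: L]
[Stringari1995, LSSY2005, Fournais2020, LiebSeiringerYngvason2005]
#9 SmoothPartner (support) — every repulsive finite-range w (a(w) ≤ R₀ < ∞ by
scatteringLength_le_range) has a bounded smooth-class partner v (finite, C², finite range, edge
condition) with scatteringLength v = scatteringLength w: take v_s = s·(16a² − |x|²)₊⁴ (a = a(w) > 0;
v = 0 if a = 0, scatteringLength_zero); s ↦ a(v_s) is concave (infimum of affine functionals), hence
continuous on (0,∞), ≤ s∫v₁/(8π) → 0 (four_pi_mul_scatteringLength_le) and ≥ a(square well of height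
s·(12a²)⁴ on [0,2a]) → 2a (scatteringLength_squareWell, scatteringLength_mono); intermediate value
theorem. [difficulty: M] [LSSY2005, LiebYngvason1998]

TWO-LAYER PLAN. Foreseen glued splits (k ≤ 3, depth 1), filed only after a crux moves:
NonCondensateRemainders ⇐ CurrentRemainder (Σ‖A_k^(nc)Ψ‖²/|k|⁴ ≤ εN²)
→ DensityRemainder (Σ‖ρ_k^(nc†)Ψ‖² ≤ εN²) → NonCondensateRemainders; CondensateNumberConcentration ⇐
ZeroModeFSum (m₁(N̂₀) =
½⟨[N̂₀,[V,N̂₀]]⟩ ≤ C·ρN‖v‖₁, provable) → ZeroMomentumSectorGap (gap of H_t above Ψ_t in the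
N̂₀-charge-changing directions ≥ ω_N·a/L³,
ω_N → ∞) → CondensateNumberConcentration (glue: Var ≤ √(m₁m₋₁), m₋₁ ≤ m₀/Δ); LongWaveStructureBound
⇐ SectorwiseBoxBound (Fournais
Thm 2.1 with a ρ_μ-grid at fixed geometry) → SlidingBookkeeping (Lemmas 3.2/3.3 with flat-top χ,
boundary-layer covering) →
LongWaveStructureBound. ScatteringLengthTransfer is shared: its decomposition belongs to route
EqualScatteringTransfer.

KILL CRITERIA. ¬CondensateNumberConcentration (Var N̂₀ ≳ N² for torus ground states at arbitrarily
small ρ, e.g. a first-order transition along t)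
closes the route (close --reason refuted:CondensateNumberConcentration): the bootstrap has no
substitute. ¬NonCondensateRemainders (e.g.
Σ_IR ‖ρ^(nc†)Ψ₀‖² ≥ cN², or a log L in the current remainder) closes it as well.
¬LongWaveStructureBound forces a pivot to the card's
static-response crux (χ_(N,L)(k) ≤ C/(ρa), second-order energy in a slowly varying field) as an
explicit item. ¬ScatteringLengthTransfer
does not kill the mechanism: the target shrinks to the smooth class and the conjunct then waits for
the comparison cards
(repulsion-monotone-hard-sphere). ¬BoundaryTransferWeak kills every torus route's last step, not the
mechanism. A refutation of a
support as misstated is repaired by a primed item (factor/regularity), never by rewording in place.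
PeriodicBEC proved elsewhere moots
items 0, 2, 3, 4 and the supports.

NOT DECOMPOSED YET. The per-mode projection identities, Parseval for γ and for u ↦ N_(Λ_u), the
Hölder bookkeeping of M₃'s potential part, the sector-wise
convexity argument, the t-uniformity lemmas (E₀(tv) ≤ E₀(v), class closed under v ↦ tv with edge
constant √t·Cₑ), the IVT for
s ↦ a(v_s) — all ride as prover lemmas with --supports SumRuleChainGlue / LongWaveStructureBound /
SmoothPartner; the transverse current
(where diamagnetism is non-trivial) is unused; T > 0 and d = 2 are out of scope; no
Poincaré-inequality attempt on Ψ₀² for crux 3 is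
filed yet; no static-response item (card C2) until LongWaveStructureBound fails.

CHEAPEST FALSIFIER. Bogoliubov insertion (redone by hand, passes): R_A(k) =
½Σ_p(2p·k+k²)²(u_pv_(p+k) − v_pu_(p+k))² = O(|k|⁴N√(ρa³)) (exact zero at k = 0),
R_ρ(k) = ½Σ_p(u_pv_(p+k) + v_pu_(p+k))² = O(N√(ρa³)), Var N̂₀ = O(N√(ρa³))
(GiorginiPitaevskiiStringari1998 at T = 0); a refuter should redo it
in a number-conserving Bogoliubov theory (terms ⟨N̂₀n̂_k⟩ − n₀n_k) and run the d = 1 sanity check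
(the IR sum N√e₃Σ1/|k| ~ N√e₃ L log
must exceed N: no conclusion in 1D, as Lieb–Liniger and PitaevskiiStringariOneDimension demand — it
does, since Σ_(k∈2πℤ/L) 1/|k| diverges
with L). Cheapest numerics: exact diagonalisation of N ≤ 8 soft bosons on a small 3D torus lattice —
check the per-mode inequality
n₀ + E[N̂₀(n̂_k+n̂_−k)] + n_−k ≤ ½[(√m₂+√R_A)²/|k|⁴ + (‖ρ_k†Ψ‖+√R_ρ)²] with m₂ ≤ 2√(N|k|²M₃), and
the size of Var(N̂₀)/N² along
t ∈ (0,1] (kit, few node-hours; not run here — hub is compute-free for planners this session).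

NUMBERS. IR window |k| < Λ√(ρa): mode count/N = Λ³√(ρa³)/(6π²); Σ_IR 1/|k| = (N/ρ)Λ²ρa/(4π²); UV
depletion ≤ KE/(Λ²ρa) ≤ 8πN/Λ²; e₃ = M₃/(N|k|⁴) ≤
|k|² + 96πaρ + C(R₀,Cₑ,a)K^(−3/2)ρ^(1/4); engine constant 4 (m₂² ≤ 4m₁M₃, symmetry-free);
Bogoliubov: 1 − x = (8/(3√π))√(ρa³), n_k ≈
√(16πρa)/(4|k|) for |k| ≪ √(ρa) (ħ = 2m = 1), R_A/|k|⁴ ~ R_ρ ~ Var N̂₀ ~ N√(ρa³); LSSY2005 Thm 2.2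
proved in tree; box ℓ = (K√(ρa))⁻¹,
ρℓ³ = K⁻³(ρa³)^(−1/2), GP parameter ρaℓ² = K⁻²; band threshold ε₁ + ζ < 3/16, c = 1/2; items at
open: 13 (5 cruxes, 1 target, 6 supports, 1 assembly).

DEFINITION REQUESTS. None needed at open: all statements are inline over
Literature.MathematicalPhysics.QuantumManyBody.BoseGas.{PeriodicTrialState,
periodicEnergy, periodicGroundStateEnergy, condensateOccupation, cell, cellN, cellWave, latticeVec,
slidingBox, scatteringLength,
sideLength, HasGroundStateBEC, IsRepulsiveFiniteRange} (lean search --decl: all present). Nice to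
have later (would shorten items 2–4 and
the glue): momentumOccupation, structureFactor, zeroModeSecondMoment, nonCondensateCurrent in
Literature/MathematicalPhysics/QuantumManyBody.

Novelty: Searches (2026-08-15, this seat): `lit galaxy search "f-sum rule condensate fraction" --star all` (0
rows), `"bound on the condensate
fraction" --star all` (0), `"sum rules and Bose-Einstein condensation" --star panama` (0), `--star
panama --title-contains "Bose-Einstein
Condensation" "sum rules"` (6 books: Griffin–Snoke–Stringari 1995 panama:267378894045222,
Pistolesi's SNS thesis on the infrared
behaviour of the bosonic limit panama:296292613881941, Ueda, Pethick–Smith,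
Proukakis–Snoke–Littlewood, Moskalenko–Snoke),
`--in-book 267378894045222 "upper bound"` (1 hit) and `lit galaxy read panama:267378894045222
--chars 196000-212000` = Stringari1995
§2.2–2.3 read in full: eqs. (8)–(11) uncertainty inequality ⇒ n(q) ≥ n₀/(4S(q)) − ½ and the 1D
no-go, (14)–(18) Goldstone-type upper
bounds on ω₀, (19)–(23) A = q·j_q = [H,ρ_q] and the cubic sum rule N(q²/m)[(q²/2m)² + (2q²/m)⟨E_K⟩ +
(ρ/m)∫(1−cos qz)g∇_z²V] — our M₃ —
used only to bound ω₀(q) from above, plus the remark that j_q = q√(Nn₀)/2m(a_q† − a_−q) holds "in a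
translationally invariant dilute
Bose gas" (the c-number identification, unquantified); `lit search` / `lit frontier` (searchd rc 75
this session, not available);
inherited: the card's five novelty audits (Simon doi:10.1103/physrevlett.36.1083, CorginiSankovich
doi:10.1142/s0217979299002988,
doi:10.1007/bf02070245, Leggett doi:10.1088/1367-2630/3/1/323, Stringari1995 pp. 72–77) and the
retired route's six crossref queries.
Nearest prior art found: Stringari1995 §2.3 (ev  [refs: 10.1103/physrevlett.36.1083, 10.1142/s0217979299002988, 10.1007/bf02070245, 10.1088/1367-2630/3/1/323, doi:10.1103/physrevlett.36.1083, doi:10.1142/s0217979299002988, doi:10.1007/bf02070245, doi:10.1088/1367-2630/3/1/323, Stringari1995, PitaevskiiStringari1991, LiebSeiringerYngvason2005, GiorginiPitaevskiiStringari1998]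

Barriers (technique_class: sum-rules, c-number-split, coupling-bootstrap, ground-state): - technique_class: sum-rules, c-number-split, coupling-bootstrap, ground-state
- Literature.Barriers.AtomisticToContinuum.HalfFillingReflectionPositivity: no reflection positivity
anywhere; the domination step is the exact f-sum × cubic-moment Cauchy–Schwarz, valid in the
continuum at any filling; honest limit: it dominates the CURRENT and reaches the order parameter
only through the split (cruxes 2, 3).
- Literature.Barriers.AtomisticToContinuum.KineticGapLengthScales: evaded by the chain (only
positive moments m₁, m₂, M₃, so k = 2π/L is harmless; UV cut by kinetic energy at Λ√(ρa), no gap at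
scale L); a gap is inverted only inside the fixed-N supports (NearMinimiserStability,
CouplingContinuity), where no uniformity in N is needed — and inside crux 3, where it is the
declared risk.
- Literature.Barriers.AtomisticToContinuum.EnergyAsymptoticsWithoutCondensation: evaded — only
one-sided inputs (LSSY upper bound; Fournais' localized lower bound through convexity) enter; no
matching of asymptotics; consistent with 1D, where the chain's IR sum exceeds N and concludes
nothing. It bears on crux 6 (universality in a), conceded there.
- Literature.Barriers.AtomisticToContinuum.BogoliubovPerturbationInfrared: it does not evade it; the
bet is that the two specific summed remainders of crux 2 are small for a structural reason
(pair-current cancellation, exact at k = 0 by momentum conservation) rather than by summing a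
series; the log of d = 3 marginality would show first in the current

History (route lifecycle, newest last):
- 2026-08-16T03:43:53Z · AUTO-CRUX (backfill): SmoothPeriodicBEC — hypotheses of the deciding theorem that nothing in the route derives are cruxes (operator:999:586464)
- 2026-08-25T01:45:05Z · DORMANT — reconciler: no traction for 7.3 d (last activity item-evidence-added at 2026-08-17T18:55:01Z); parked, not closed — `ledger route dormant route-AtomisticToConti (operator:999:333612)

sub-problem: BoseEinsteinCondensation · status: dormant · opened planner-plancard-AtomisticToContinuum-BoseEin-8d5d457b-g2-0 2026-08-15T18:58:14Z · rev 1 · ledger route-AtomisticToContinuum-BECPhaseQuadratureSumRule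
GENERATED by the gate from the ledger (D-0016/17). Provers cite these decls: `theorem foo : Summit.AtomisticToContinuum.BoseEinsteinCondensation.Theses.BECPhaseQuadratureSumRule.<Decl> := …` in Summits/AtomisticToContinuum/BoseEinsteinCondensation/Theorems/<Name>.lean.
-/

namespace Summit.AtomisticToContinuum.BoseEinsteinCondensation.Theses.BECPhaseQuadratureSumRule

open scoped BigOperators Topology Manifold Classical MeasureTheory ProbabilityTheory Matrix InnerProductSpace ComplexConjugate ContinuousMap
open Filter Set Function TopologicalSpace MeasureTheory

attribute [summit_statement] _root_.BoseEinsteinCondensation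

/-- item stmt-AtomisticToContinuum-11783 · crux (kind.auto-crux: conjecture-grade) · rank 0 · open · by planner
why it might fail: contains the open thermodynamic-limit BEC problem for smooth potentials (LSSY2005 Ch. 5; Fournais2020/Junge2026/ChongLiangNam2026 stop at L ≲ a(ρa³)^(−3/4−η)).
sources: LSSY2005, Fournais2020, Junge2026, ChongLiangNam2026
[target] (verbatim the statement of stmt-AtomisticToContinuum-6733 of the retired route
BECSumRuleBootstrap, re-filed) PeriodicBEC restricted to the smooth class: for every repulsive
finite-range v that is finite, C² as ṽ(x) = v(|x|) on ℝ³, with ‖D²ṽ‖ ≤ Cₑ√ṽ, there is ρ₀ > 0 such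
that for 0 < ρ < ρ₀ there is c > 0 with: for all large N there is δ > 0 such that every periodic
trial state on the torus of side (N/ρ)^{1/3} with periodicEnergy ≤ E₀^per + δ has constant-mode
occupation ≥ cN. It is what X delivers through IMUChainGlue. -/
@[route_item "route-AtomisticToContinuum-BECPhaseQuadratureSumRule", crux]
def SmoothPeriodicBEC : Prop :=
  open Literature.MathematicalPhysics.QuantumManyBody.BoseGas in ∀ v : ℝ → ENNReal, IsRepulsiveFiniteRange v → (∀ r, v r ≠ ⊤) → ContDiff ℝ 2 (fun x : Space => (v ‖x‖).toReal) → (∃ Cₑ : ℝ, ∀ x : Space, ‖iteratedFDeriv ℝ 2 (fun x : Space => (v ‖x‖).toReal) x‖ ≤ Cₑ * Real.sqrt ((v ‖x‖).toReal)) → ∃ ρ₀ : ℝ, 0 < ρ₀ ∧ ∀ ρ : ℝ, 0 < ρ → ρ < ρ₀ → ∃ c : ℝ, 0 < c ∧ ∀ᶠ N : ℕ in Filter.atTop, ∃ δ : ENNReal, 0 < δ ∧ ∀ Ψ : PeriodicTrialState N (sideLength ρ N), periodicEnergy v Ψ ≤ periodicGroundStateEnergy v N (sideLength ρ N) + δ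 → ENNReal.ofReal (c * N) ≤ condensateOccupation N (sideLength ρ N) Ψ.ψ

/-- item stmt-AtomisticToContinuum-12615 · crux · rank 2 · open · by planner
why it might fail: 4-point functions of the depletion with no a-priori handle (Cauchy–Schwarz gives N₊|k|²⟨T⟩, useless); smallness rests on Bogoliubov's pair-current cancellation, unproved for Ψ₀ (Gavoret–Nozières territory); a log L in the current remainder already breaks ε.
sources: LiebSeiringerYngvason2005, Stringari1995, GavoretNozieres1964, Griffin1993, Literature.Barriers.AtomisticToContinuum.BogoliubovPerturbationInfrared
[crux] (card C1, corrected and summed) for the torus minimiser Ψ of −Σ∆ⱼ + tΣv^per (t ∈ (0,1], L =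
(N/ρ)^(1/3), ρ < ρ₀(Λ,ε), N large): Σ over 0 < |k| < Λ√(ρa), k = 2πn/L, of ‖A_k^(nc)Ψ‖²/|k|⁴ +
‖ρ_k^(nc†)Ψ‖² is ≤ εN², where A_k^(nc) = Σⱼ Qⱼe^(ik·xⱼ)(−2ik·∇ⱼ + |k|²)Qⱼ and ρ_k^(nc†) = Σⱼ
Qⱼe^(ik·xⱼ)Qⱼ (Q = 1 − |φ₀⟩⟨φ₀|, written with cell averages) are the non-condensate parts of the
longitudinal current [H,ρ_k†] and of the density. Bogoliubov: O(|k|⁴N√(ρa³)) resp. O(N√(ρa³)) per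
mode (pair currents (u_pv_q − v_pu_q)² cancel at k = 0), summed O(Λ³ρa³N²) — no log. [difficulty:
open-problem] -/
@[route_item "route-AtomisticToContinuum-BECPhaseQuadratureSumRule", crux]
def NonCondensateRemainders : Prop :=
  open Literature.MathematicalPhysics.QuantumManyBody.BoseGas in ∀ v : ℝ → ENNReal, IsRepulsiveFiniteRange v → (∀ r, v r ≠ ⊤) → ContDiff ℝ 2 (fun x : Space => (v ‖x‖).toReal) → (∃ Cₑ : ℝ, ∀ x : Space, ‖iteratedFDeriv ℝ 2 (fun x : Space => (v ‖x‖).toReal) x‖ ≤ Cₑ * Real.sqrt ((v ‖x‖).toReal)) → ∀ Λ : ℝ, 0 < Λ → ∀ ε : ℝ, 0 < ε → ∃ ρ₀ : ℝ, 0 < ρ₀ ∧ ∀ ρ : ℝ, 0 < ρ → ρ < ρ₀ → ∀ᶠ N : ℕ in Filter.atTop, ∀ t : ℝ, 0 < t → t ≤ 1 → ∀ Ψ : PeriodicTrialState N (sideLength ρ N), (let L : ℝ := sideLength ρ N; let w : ℝ → ENNReal := fun r => ENNReal.ofReal t * v r; periodicEnergy w Ψ = periodicGroundStateEnergy w N L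 → periodicEnergy w Ψ ≠ ⊤ → (∑' n : Fin 3 → ℤ, {n : Fin 3 → ℤ | n ≠ 0 ∧ ‖((2 * Real.pi / L) • latticeVec 1 n)‖ < Λ * Real.sqrt (ρ * (scatteringLength v).toReal)}.indicator (fun n => (∫⁻ X in cellN N L, (‖∑ j : Fin N, (cellWave L n (X j) * ((-2 * Complex.I) * fderiv ℝ Ψ.ψ X (Pi.single j ((2 * Real.pi / L) • latticeVec 1 n)) + (((‖((2 * Real.pi / L) • latticeVec 1 n)‖ ^ 2 : ℝ)) : ℂ) * (Ψ.ψ X - (((L ^ 3)⁻¹ : ℝ) : ℂ) * ∫ y in cell L, Ψ.ψ (Function.update X j y))) + (((‖((2 * Real.pi / L) • latticeVec 1 n)‖ ^ 2 : ℝ)) : ℂ) * ((((L ^ 3)⁻¹ : ℝ) : ℂ) * ∫ y in cell L, cellWave L n y * Ψ.ψ (Function.update X j y)))‖₊ : ENNReal) ^ 2) / ENNReal.ofReal (‖((2 * Real.pi / L) • latticeVec 1 n)‖ ^ 4) + (∫⁻ X in cellN N L, (‖∑ j : Fin N, (cellWave L n (X j) * (Ψ.ψ X - (((L ^ 3)⁻¹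 : ℝ) : ℂ) * ∫ y in cell L, Ψ.ψ (Function.update X j y)) - (((L ^ 3)⁻¹ : ℝ) : ℂ) * ∫ y in cell L, cellWave L n y * Ψ.ψ (Function.update X j y))‖₊ : ENNReal) ^ 2)) n) ≤ ENNReal.ofReal (ε * (N : ℝ) ^ 2))

/-- item stmt-AtomisticToContinuum-12616 · crux · rank 3 · open · by planner
why it might fail: equivalent to excluding a macroscopic superposition of a condensed and an uncondensed branch (an avoided crossing at some t* ≤ 1 at finite N); reducible to m₁(N̂₀) = O(Nρ) plus a P=0-sector gap ≫ a/L³, and no N-uniform gap bound is known.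
sources: GiorginiPitaevskiiStringari1998, LiebSeiringerYngvason2005, LSSY2005, Literature.Barriers.AtomisticToContinuum.SymmetryBreakingWithoutCondensate
[crux] along the coupling path the zero-mode number N̂₀ = ΣⱼPⱼ of the torus minimiser satisfies
E[N̂₀²] = N(N−1)‖P₁P₂Ψ‖² + n₀ ≤ n₀² + ζN² for N large, every ζ > 0, ρ < ρ₀(ζ), uniformly in t ∈
(0,1] (Var(N̂₀/N) → 0); with the chain's dichotomy E[N̂₀(N−N̂₀)] ≤ εN² this gives x(1−x) ≤ ε + ζ for
x = n₀/N. Bogoliubov: Var N̂₀ = Σ_k 2u_k²v_k² = O(N√(ρa³)). [difficulty: XL] -/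
@[route_item "route-AtomisticToContinuum-BECPhaseQuadratureSumRule", crux]
def CondensateNumberConcentration : Prop :=
  open Literature.MathematicalPhysics.QuantumManyBody.BoseGas in ∀ v : ℝ → ENNReal, IsRepulsiveFiniteRange v → (∀ r, v r ≠ ⊤) → ContDiff ℝ 2 (fun x : Space => (v ‖x‖).toReal) → (∃ Cₑ : ℝ, ∀ x : Space, ‖iteratedFDeriv ℝ 2 (fun x : Space => (v ‖x‖).toReal) x‖ ≤ Cₑ * Real.sqrt ((v ‖x‖).toReal)) → ∀ ζ : ℝ, 0 < ζ → ∃ ρ₀ : ℝ, 0 < ρ₀ ∧ ∀ ρ : ℝ, 0 < ρ → ρ < ρ₀ → ∀ᶠ n : ℕ in Filter.atTop, ∀ t : ℝ, 0 < t → t ≤ 1 → ∀ Ψ : PeriodicTrialState (n + 2) (sideLength ρ (n + 2)), (let L : ℝ := sideLength ρ (n + 2); let w : ℝ → ENNReal := fun r => ENNReal.ofReal t * v r; periodicEnergy w Ψ = periodicGroundStateEnergy w (n + 2) L → periodicEnergy w Ψ ≠ ⊤ → ((n + 2 : ℕ) : ENNReal) * ((n + 1 : ℕ) : ENNReal) *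 (∫⁻ Y in cellN n L, (‖∫ x in cell L, ∫ y in cell L, Ψ.ψ (Matrix.vecCons x (Matrix.vecCons y Y))‖₊ : ENNReal) ^ 2) / ENNReal.ofReal (L ^ 6) + condensateOccupation (n + 2) L Ψ.ψ ≤ condensateOccupation (n + 2) L Ψ.ψ ^ 2 + ENNReal.ofReal (ζ * ((n : ℝ) + 2) ^ 2))

/-- item stmt-AtomisticToContinuum-12617 · crux · rank 4 · open · by planner
why it might fail: meant to follow from convexity: Fournais2020 Thm 2.1 (proved) box-wise on a K-grid vs Dyson's upper bound at GP parameter ρaℓ² = K⁻²; if the constants are not uniform on the grid or the flat-top χ boundary layer leaks, it needs an LHY-precision upper bound.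
sources: Fournais2020, BrietzkeFournaisSolovej2020, LSSY2005, YauYin2009, BastiCenatiempoSchlein2021
[crux] long-wave number fluctuations of the torus minimiser are relatively small: with ℓ =
(K√(ρa))⁻¹ and periodised sliding boxes Λ_u(ℓ), L⁻³∫_cell E_Ψ[N_(Λ_u)²] du ≤ (1+ε)(ρℓ³)² for N
large, every K, ε > 0, ρ < ρ₀(K,ε), uniformly in t. By Parseval in u it gives Σ_(0<|k|<πK√(ρa))
‖ρ_k†Ψ‖² ≤ (π/2)⁶εN² (all the static-structure input the chain needs) and the close-pair count
E[#{i<j: |xᵢ−xⱼ| < R₀}] ≤ 4(1+ε)Nρℓ³ entering M₃. [difficulty: L] -/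
@[route_item "route-AtomisticToContinuum-BECPhaseQuadratureSumRule", crux]
def LongWaveStructureBound : Prop :=
  open Literature.MathematicalPhysics.QuantumManyBody.BoseGas in ∀ v : ℝ → ENNReal, IsRepulsiveFiniteRange v → (∀ r, v r ≠ ⊤) → ContDiff ℝ 2 (fun x : Space => (v ‖x‖).toReal) → (∃ Cₑ : ℝ, ∀ x : Space, ‖iteratedFDeriv ℝ 2 (fun x : Space => (v ‖x‖).toReal) x‖ ≤ Cₑ * Real.sqrt ((v ‖x‖).toReal)) → ∀ K : ℝ, 0 < K → ∀ ε : ℝ, 0 < ε → ∃ ρ₀ : ℝ, 0 < ρ₀ ∧ ∀ ρ : ℝ, 0 < ρ → ρ < ρ₀ → ∀ᶠ N : ℕ in Filter.atTop, ∀ t : ℝ, 0 < t → t ≤ 1 → ∀ Ψ : PeriodicTrialState N (sideLength ρ N), (let L : ℝ := sideLength ρ N; let w : ℝ → ENNReal := fun r => ENNReal.ofReal t * v r; periodicEnergy w Ψ = periodicGroundStateEnergy w N L → periodicEnergy w Ψ ≠ ⊤ → (let ℓ : ℝ := (K * Real.sqrt (ρ * (scatteringLength v).toReal))⁻¹; (∫⁻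 u in cell L, ∫⁻ X in cellN N L, (∑ j : Fin N, ∑' m : Fin 3 → ℤ, (slidingBox ℓ u).indicator (fun _ => (1 : ENNReal)) (X j + latticeVec L m)) ^ 2 * (‖Ψ.ψ X‖₊ : ENNReal) ^ 2) ≤ ENNReal.ofReal ((1 + ε) * (ρ * ℓ ^ 3) ^ 2 * L ^ 3)))

/-- item stmt-AtomisticToContinuum-0827 · crux · rank 5 · open · by planner
why it might fail: PeriodicBEC(v) is ground-state-only (δ after N); the Dirichlet GS is a periodic trial state but lies a wall term ≫ δ above E₀^per, so no energy-comparison proof; only the ENERGY transfer is in print; BEC can be boundary-condition sensitive.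
sources: LSSY2005, arXiv:2203.01841, arXiv:2205.15284, doi:10.1007/bf01608554
[crux] BoundaryTransferWeak (mode-free boundary-condition transfer, per potential): for each
repulsive finite-range v, PeriodicBEC(v) implies ∃ρ₀>0 ∀ρ∈(0,ρ₀) HasGroundStateBEC v ρ (Dirichlet
ground state, λ_max(γ) ≥ cN via condensateNumber). Not glue: near-minimiser slacks are O(N/L²) while
Dirichlet/periodic energies differ by a boundary term ≫ N/L², so no energy-comparison proof;
expected route: Neumann bracketing of interior sub-boxes (−Δ_Dir ≥ ⊕−Δ_Neu, v ≥ 0) + a mode-free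
criterion (λ_max ≥ tr γ²/N). Only the ENERGY analogue is in print (LiebSeiringerSolovejYngvason2005
Ch. 2 after (2.8)). v ≡ 0: hypothesis and conclusion both true. -/
@[route_item "route-AtomisticToContinuum-BECPhaseQuadratureSumRule", crux]
def BoundaryTransferWeak : Prop :=
  ∀ v : ℝ → ENNReal, Literature.MathematicalPhysics.QuantumManyBody.BoseGas.IsRepulsiveFiniteRange v → (∃ ρ₀ : ℝ, 0 < ρ₀ ∧ ∀ ρ : ℝ, 0 < ρ → ρ < ρ₀ → ∃ c : ℝ, 0 < c ∧ ∀ᶠ N : ℕ in Filter.atTop, ∃ δ : ENNReal, 0 < δ ∧ ∀ Ψ : Literature.MathematicalPhysics.QuantumManyBody.BoseGas.PeriodicTrialState N (Literature.MathematicalPhysics.QuantumManyBody.BoseGas.sideLength ρ N), Literature.MathematicalPhysics.QuantumManyBody.BoseGas.periodicEnergy v Ψ ≤ Literature.MathematicalPhysics.QuantumManyBody.BoseGas.periodicGroundStateEnergy v N (Literature.MathematicalPhysics.QuantumManyBody.BoseGas.sideLength ρ N) + δ → ENNReal.ofReal (c * N) ≤ Literature.MathematicalPhysics.QuantumManyBody.BoseGas.condensateOccupation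 N (Literature.MathematicalPhysics.QuantumManyBody.BoseGas.sideLength ρ N) Ψ.ψ) → ∃ ρ₀ : ℝ, 0 < ρ₀ ∧ ∀ ρ : ℝ, 0 < ρ → ρ < ρ₀ → Literature.MathematicalPhysics.QuantumManyBody.BoseGas.HasGroundStateBEC v ρ

/-- item stmt-AtomisticToContinuum-9048 · crux · rank 6 · open · by planner
why it might fail: false iff hard- and soft-core gases of equal a differ w.r.t. BEC (LSSY2005 Ch. 2 open question, BEC form); implied by the conjunct, so no cheap refutation, but every proof idea needs an N-uniform corrector/monotonicity bound (none known).
sources: LSSY2005, LiebYngvason1998, doi:10.1103/physreva.60.5129, Literature.Barriers.AtomisticToContinuum.EnergyAsymptoticsWithoutCondensation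
[crux] shared verbatim with route EqualScatteringTransfer (stmt-AtomisticToContinuum-4285): for
admissible v (bounded) and w with equal scattering length, small-density Dirichlet BEC transfers
from v to w — here it carries the Born-regime corner to every admissible potential, hard cores
included. [difficulty: XL] -/
@[route_item "route-AtomisticToContinuum-BECPhaseQuadratureSumRule", crux]
def ScatteringLengthTransfer : Prop :=
  ∀ v w : ℝ → ENNReal, Literature.MathematicalPhysics.QuantumManyBody.BoseGas.IsRepulsiveFiniteRange v → Literature.MathematicalPhysics.QuantumManyBody.BoseGas.IsRepulsiveFiniteRange w → (∃ M : NNReal, ∀ r, v r ≤ M) → Literature.MathematicalPhysics.QuantumManyBody.BoseGas.scatteringLength v = Literature.MathematicalPhysics.QuantumManyBody.BoseGas.scatteringLength w → (∃ ρ₀ : ℝ, 0 < ρ₀ ∧ ∀ ρ : ℝ, 0 < ρ → ρ < ρ₀ → Literature.MathematicalPhysics.QuantumManyBody.BoseGas.HasGroundStateBEC v ρ) → ∃ ρ₀ : ℝ, 0 < ρ₀ ∧ ∀ ρ : ℝ, 0 < ρ → ρ < ρ₀ → Literature.MathematicalPhysics.QuantumManyBody.BoseGas.HasGroundStateBEC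 w ρ

/-- item stmt-AtomisticToContinuum-11788 · support · rank 9 · closed · proved by Summit.AtomisticToContinuum.BoseEinsteinCondensation.Theorems.nearMinimiserStability_proof (prover) · by planner
sources: ReedSimonIV1978, LSSY2005
[support] (verbatim the statement of retired stmt-AtomisticToContinuum-6740, re-filed) at fixed N,
L: for every ε > 0 there is δ > 0 such that every δ-near-minimiser Φ has condensateOccupation ≥ that
of a minimiser Ψ minus εN (discrete spectrum and simple ground state by positivity improvement: ‖Φ −
e^{iθ}Ψ‖² ≤ δ/gap; n₀ is 2N-Lipschitz on the unit sphere of L²); N = 0, 1 trivial. [difficulty: M] -/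
@[route_item "route-AtomisticToContinuum-BECPhaseQuadratureSumRule", crux]
def NearMinimiserStability : Prop :=
  open Literature.MathematicalPhysics.QuantumManyBody.BoseGas in ∀ v : ℝ → ENNReal, IsRepulsiveFiniteRange v → (∀ r, v r ≠ ⊤) → ContDiff ℝ 2 (fun x : Space => (v ‖x‖).toReal) → (∃ Cₑ : ℝ, ∀ x : Space, ‖iteratedFDeriv ℝ 2 (fun x : Space => (v ‖x‖).toReal) x‖ ≤ Cₑ * Real.sqrt ((v ‖x‖).toReal)) → ∀ N : ℕ, ∀ L : ℝ, 0 < L → periodicGroundStateEnergy v N L ≠ ⊤ → ∀ ε : ℝ, 0 < ε → ∃ δ : ENNReal, 0 < δ ∧ ∀ Ψ Φ : PeriodicTrialState N L, periodicEnergy v Ψ = periodicGroundStateEnergy v N L → periodicEnergy v Φ ≤ periodicGroundStateEnergy v N L + δ → condensateOccupation N L Ψ.ψ ≤ condensateOccupation N L Φ.ψ + ENNReal.ofReal (ε * N)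

/-- item stmt-AtomisticToContinuum-12618 · support · rank 9 · closed · proved by Summit.AtomisticToContinuum.BoseEinsteinCondensation.Theorems.currentSumRule_proof @ 813861069e5d (prover) · by planner
sources: Puff1965, Wagner1966, Stringari1995, PitaevskiiStringari1991, KLS1988PRL
[support] (the engine, variational form, NO symmetry needed) for t ∈ (0,1], 2R₀ < L and every C³
periodic finite-energy minimiser Ψ of −Σ∆ + tΣv^per, for every k = 2πn/L ≠ 0: m₂² ≤ 4·m₁·M₃ with m₂
= ‖Σⱼe^(ik·xⱼ)(−2ik·∇ⱼ+|k|²)Ψ‖² (= ‖[H,ρ_k†]Ψ‖²), m₁ = N|k|² and M₃ = 12|k|²Σⱼ‖(k·∇ⱼ)Ψ‖² + N|k|⁶ +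
4E_Ψ[Σ_(i<j)(1−cos k·(xᵢ−xⱼ))|(k·∇)²(tṽ^per)(xᵢ−xⱼ)|]. Proof: q(φ) := ⟨φ,(H−E₀)φ⟩ ≥ 0 (variational),
discriminant of q(sA_kΨ − ρ_k†Ψ) = s²q(A_kΨ) − 2sm₂ + q(ρ_k†Ψ) gives m₂² ≤ q(A_kΨ)q(ρ_k†Ψ); the
double commutators [ρ_k,[H,ρ_k†]] = 2N|k|² and ⟨[A_k†,[H,A_k]]⟩ = 2N|k|⁶ + 24|k|²Σ‖(k·∇ⱼ)Ψ‖² +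
8E[Σ(1−cos)∂_k²(tṽ)] bound q(ρ_k†Ψ) + q(ρ_−k†Ψ) and q(A_kΨ) + q(A_−kΨ), each term ≥ 0 — weak
Euler–Lagrange equation + integration by parts only, no spectral theorem, no uniqueness.
[difficulty: M] -/
@[route_item "route-AtomisticToContinuum-BECPhaseQuadratureSumRule", crux]
def CurrentSumRule : Prop :=
  open Literature.MathematicalPhysics.QuantumManyBody.BoseGas in ∀ v : ℝ → ENNReal, IsRepulsiveFiniteRange v → (∀ r, v r ≠ ⊤) → ContDiff ℝ 2 (fun x : Space => (v ‖x‖).toReal) → (∃ Cₑ : ℝ, ∀ x : Space, ‖iteratedFDeriv ℝ 2 (fun x : Space => (v ‖x‖).toReal) x‖ ≤ Cₑ * Real.sqrt ((v ‖x‖).toReal)) → ∀ R₀ : ℝ, 0 < R₀ → (∀ r, R₀ < r → v r = 0) → ∀ t : ℝ, 0 < t → t ≤ 1 → ∀ N : ℕ, ∀ L : ℝ, 2 * R₀ < L → ∀ Ψ : PeriodicTrialState N L, ContDiff ℝ 3 Ψ.ψ → (let w : ℝ → ENNReal := fun r => ENNReal.ofReal t * v r; periodicEnergy w Ψ = periodicGroundStateEnergy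 w N L → periodicEnergy w Ψ ≠ ⊤ → ∀ n : Fin 3 → ℤ, n ≠ 0 → (∫⁻ X in cellN N L, (‖∑ j : Fin N, cellWave L n (X j) * ((-2 * Complex.I) * fderiv ℝ Ψ.ψ X (Pi.single j ((2 * Real.pi / L) • latticeVec 1 n)) + (((‖((2 * Real.pi / L) • latticeVec 1 n)‖ ^ 2 : ℝ)) : ℂ) * Ψ.ψ X)‖₊ : ENNReal) ^ 2) ^ 2 ≤ 4 * (ENNReal.ofReal ((N : ℝ) * ‖((2 * Real.pi / L) • latticeVec 1 n)‖ ^ 2) * (ENNReal.ofReal (12 * ‖((2 * Real.pi / L) • latticeVec 1 n)‖ ^ 2) * (∑ j : Fin N, ∫⁻ X in cellN N L, (‖fderiv ℝ Ψ.ψ X (Pi.single j ((2 * Real.pi / L) • latticeVec 1 n))‖₊ : ENNReal) ^ 2) + ENNReal.ofReal ((N : ℝ) * ‖((2 * Real.pi / L) • latticeVec 1 n)‖ ^ 6) + 4 * ∫⁻ X in cellN N L, (∑ i : Fin N, ∑ j : Fin N with i < j, ENNReal.ofReal ((1 - Real.cos (inner ℝ ((2 * Real.pi / L) • latticeVec 1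 n) (X i - X j))) * |fderiv ℝ (fun z : Space => fderiv ℝ (fun z : Space => ∑' m : Fin 3 → ℤ, t * (v ‖z - latticeVec L m‖).toReal) z ((2 * Real.pi / L) • latticeVec 1 n)) (X i - X j) ((2 * Real.pi / L) • latticeVec 1 n)|)) * (‖Ψ.ψ X‖₊ : ENNReal) ^ 2)))

/-- item stmt-AtomisticToContinuum-12619 · support · rank 9 · closed · proved by Summit.AtomisticToContinuum.BoseEinsteinCondensation.Theorems.minimiserRegularity_proof @ 00fcba88798a (prover) · by planner
sources: ReedSimonIV1978, LSSY2005
[support] for every class potential, N ≥ 1 and L > 0 the periodic N-body energy has a minimiser in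
the C¹ periodic Bose-symmetric class which is C³ with finite energy (Rellich on the torus, Schauder
C^(3,α) for V ∈ C², bosonic ground state = absolute ground state). [difficulty: L] -/
@[route_item "route-AtomisticToContinuum-BECPhaseQuadratureSumRule", crux]
def MinimiserRegularity : Prop :=
  open Literature.MathematicalPhysics.QuantumManyBody.BoseGas in ∀ v : ℝ → ENNReal, IsRepulsiveFiniteRange v → (∀ r, v r ≠ ⊤) → ContDiff ℝ 2 (fun x : Space => (v ‖x‖).toReal) → (∃ Cₑ : ℝ, ∀ x : Space, ‖iteratedFDeriv ℝ 2 (fun x : Space => (v ‖x‖).toReal) x‖ ≤ Cₑ * Real.sqrt ((v ‖x‖).toReal)) → ∀ N : ℕ, 0 < N → ∀ L : ℝ, 0 < L → ∃ Ψ : PeriodicTrialState N L, periodicEnergy v Ψ = periodicGroundStateEnergy v N L ∧ periodicEnergy v Ψ ≠ ⊤ ∧ ContDiff ℝ 3 Ψ.ψ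

/-- item stmt-AtomisticToContinuum-12626 · support · rank 9 · closed · proved by Summit.AtomisticToContinuum.BoseEinsteinCondensation.Theorems.couplingContinuity_proof (prover) · by planner
sources: Kato1966, ReedSimonIV1978
[support] at fixed N, L the constant-mode occupation of the minimiser of −Σ∆ + tΣv^per is uniformly
continuous in t ∈ [0,1] (two minimisers at the same t have the same n₀; at t = 0 the minimisers are
the constants, n₀ = N): analytic perturbation theory of a simple isolated eigenvalue (free torus gap
(2π/L)², Perron–Frobenius for t > 0). [difficulty: L] -/
@[route_item "route-AtomisticToContinuum-BECPhaseQuadratureSumRule", crux]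
def CouplingContinuity : Prop :=
  open Literature.MathematicalPhysics.QuantumManyBody.BoseGas in ∀ v : ℝ → ENNReal, IsRepulsiveFiniteRange v → (∀ r, v r ≠ ⊤) → ContDiff ℝ 2 (fun x : Space => (v ‖x‖).toReal) → (∃ Cₑ : ℝ, ∀ x : Space, ‖iteratedFDeriv ℝ 2 (fun x : Space => (v ‖x‖).toReal) x‖ ≤ Cₑ * Real.sqrt ((v ‖x‖).toReal)) → ∀ N : ℕ, ∀ L : ℝ, 0 < L → ∀ ε : ℝ, 0 < ε → ∃ δ : ℝ, 0 < δ ∧ ∀ t t' : ℝ, 0 ≤ t → t ≤ 1 → 0 ≤ t' → t' ≤ 1 → |t - t'| < δ → ∀ Ψ Ψ' : PeriodicTrialState N L, (let w : ℝ → ENNReal := fun r => ENNReal.ofReal t * v r; let w' : ℝ → ENNReal := fun r => ENNReal.ofReal t' * v r; periodicEnergy w Ψ = periodicGroundStateEnergy w N L → periodicEnergy w Ψ ≠ ⊤ → periodicEnergy w' Ψ' = periodicGroundStateEnergy w' N L → periodicEnergy w' Ψ' ≠ ⊤ → condensateOccupation N L Ψ.ψ ≤ condensateOccupation N L Ψ'.ψ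 + ENNReal.ofReal (ε * N))

/-- item stmt-AtomisticToContinuum-12627 · support · rank 9 · closed · proved by Summit.AtomisticToContinuum.BoseEinsteinCondensation.Theorems.SumRuleChainGlue.sumRuleChainGlue_proof @ 2add86e1a4c5 (prover) · by planner
sources: Stringari1995, LSSY2005, Fournais2020, LiebSeiringerYngvason2005
[support] (glue of the foreseen split) MinimiserRegularity → CouplingContinuity →
NearMinimiserStability → CurrentSumRule → LongWaveStructureBound → NonCondensateRemainders →
CondensateNumberConcentration → SmoothPeriodicBEC. Bookkeeping: (i) per-mode identity ‖A_k^cΨ‖²/|k|⁴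
+ ‖ρ_k^(c†)Ψ‖² = 2n₀ + 2E[N̂₀(n̂_k+n̂_−k)] + 2n_−k and ‖A^c‖ ≤ ‖A‖ + ‖A^(nc)‖; (ii) m₂ ≤
2√(N|k|²M₃), M₃ ≤ N|k|⁴(|k|² + 96πaρ + O(ρ^(1/4))) from Σ‖(k·∇ⱼ)Ψ‖² ≤ |k|²KE ≤ |k|²E₀(tv) ≤
|k|²E₀(v) ≤ |k|²·8πaρN (LSSY2005_upperBound_periodic_holds, scatteringLength_mono) and, for the
potential part, t‖D²ṽ‖ ≤ √t·Cₑ√(tṽ) + Cauchy–Schwarz + close-pair count ≤ 4(1+ε)Nρℓ³; (iii) Σ_IR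
‖ρ_k†Ψ‖² ≤ (π/2)⁶εN² (Parseval in u, K = Λ/π), mode count ≤ Λ³√(ρa³)N/(6π²), Σ_IR 1/|k| =
L³Λ²ρa/(4π²)(1+o(1)); (iv) UV: Σ_(|k|≥Λ√(ρa)) n_k ≤ KE/(Λ²ρa) ≤ 8πN/Λ² (cell Fourier toolkit
tsum_sq_grad_cellFourierCoeff); (v) ⇒ E[N̂₀(N−N̂₀)] ≤ ε₁N², with crux 3 x(1−x) ≤ ε₁ + ζ < 3/16 ⇒ x ∉
(1/4,3/4) for all t; CouplingContinuity, x(0) = 1 (zero kinetic energy ⇒ constant) and connectedness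
of [0,1] ⇒ x(1) ≥ 3/4; NearMinimiserStability with ε = 1/4 ⇒ c = 1/2. Degenerate a = 0:
LSSY2005_zeroScatteringLength_holds + continuity ⇒ v = 0, minimiser constant. -/
@[route_item "route-AtomisticToContinuum-BECPhaseQuadratureSumRule", crux]
def SumRuleChainGlue : Prop :=
  MinimiserRegularity → CouplingContinuity → NearMinimiserStability → CurrentSumRule → LongWaveStructureBound → NonCondensateRemainders → CondensateNumberConcentration → SmoothPeriodicBEC

/-- item stmt-AtomisticToContinuum-12628 · support · rank 9 · closed · proved by Summit.AtomisticToContinuum.BoseEinsteinCondensation.Theorems.smoothPartner_proof (prover) · by planner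
sources: LSSY2005, LiebYngvason1998
[support] every repulsive finite-range w (a(w) ≤ R₀ < ∞ by scatteringLength_le_range) has a bounded
smooth-class partner v (finite, C², finite range, edge condition) with scatteringLength v =
scatteringLength w: take v_s = s·(16a² − |x|²)₊⁴ (a = a(w) > 0; v = 0 if a = 0,
scatteringLength_zero); s ↦ a(v_s) is concave (infimum of affine functionals), hence continuous on
(0,∞), ≤ s∫v₁/(8π) → 0 (four_pi_mul_scatteringLength_le) and ≥ a(square well of height s·(12a²)⁴ on
[0,2a]) → 2a (scatteringLength_squareWell, scatteringLength_mono); intermediate value theorem.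
[difficulty: M] -/
@[route_item "route-AtomisticToContinuum-BECPhaseQuadratureSumRule", crux]
def SmoothPartner : Prop :=
  open Literature.MathematicalPhysics.QuantumManyBody.BoseGas in ∀ w : ℝ → ENNReal, IsRepulsiveFiniteRange w → ∃ v : ℝ → ENNReal, IsRepulsiveFiniteRange v ∧ (∀ r, v r ≠ ⊤) ∧ ContDiff ℝ 2 (fun x : Space => (v ‖x‖).toReal) ∧ (∃ Cₑ : ℝ, ∀ x : Space, ‖iteratedFDeriv ℝ 2 (fun x : Space => (v ‖x‖).toReal) x‖ ≤ Cₑ * Real.sqrt ((v ‖x‖).toReal)) ∧ (∃ M : NNReal, ∀ r, v r ≤ M) ∧ scatteringLength v = scatteringLength w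

/-- item stmt-AtomisticToContinuum-12629 · assembly · rank 1 · closed · proved by Summit.AtomisticToContinuum.BoseEinsteinCondensation.Theorems.becPhaseQuadratureSumRule_assembly_proof (prover) · by planner
sources: LSSY2005, Stringari1995
[assembly] SmoothPeriodicBEC → NonCondensateRemainders → CondensateNumberConcentration →
LongWaveStructureBound → BoundaryTransferWeak → ScatteringLengthTransfer → CurrentSumRule →
MinimiserRegularity → NearMinimiserStability → CouplingContinuity → SumRuleChainGlue → SmoothPartner
→ the conjunct BoseEinsteinCondensation (pure logic; term: fun h0 h2 h3 h4 hB hT hS hM hN hC hG hP w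
hw => by obtain ⟨v, hv, hfin, hC2, hedge, hbdd, ha⟩ := hP w hw; exact hT v w hv hw hbdd ha (hB v hv
(hG hM hC hN hS h4 h2 h3 v hv hfin hC2 hedge))). -/
@[route_item "route-AtomisticToContinuum-BECPhaseQuadratureSumRule", crux]
def Assembly : Prop :=
  SmoothPeriodicBEC → NonCondensateRemainders → CondensateNumberConcentration → LongWaveStructureBound → BoundaryTransferWeak → ScatteringLengthTransfer → CurrentSumRule → MinimiserRegularity → NearMinimiserStability → CouplingContinuity → SumRuleChainGlue → SmoothPartner → _root_.BoseEinsteinCondensation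

/-! D-0027 §2.1 — DECIDING THEOREM (planner-authored via `route open/edit --closes-file`; by planner-plancard-AtomisticToContinuum-BoseEin-8d5d457b-g2-0 2026-08-15T18:58:14Z):
its hypotheses are this route's items and its conclusion the sub-problem Statement (glue_lint), and it elaborates with this file. -/

@[closes "route-AtomisticToContinuum-BECPhaseQuadratureSumRule"] theorem closes (h0 : SmoothPeriodicBEC) (h2 : NonCondensateRemainders) (h3 : CondensateNumberConcentration)
    (h4 : LongWaveStructureBound) (hB : BoundaryTransferWeak) (hT : ScatteringLengthTransfer)
    (hS : CurrentSumRule) (hM : MinimiserRegularity) (hN : NearMinimiserStability) (hC : CouplingContinuity)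
    (hG : SumRuleChainGlue) (hP : SmoothPartner) (hA : Assembly) : _root_.BoseEinsteinCondensation := by
  intro w hw
  obtain ⟨v, hv, hfin, hC2, hedge, hbdd, ha⟩ := hP w hw
  exact hT v w hv hw hbdd ha (hB v hv (hG hM hC hN hS h4 h2 h3 v hv hfin hC2 hedge))

end Summit.AtomisticToContinuum.BoseEinsteinCondensation.Theses.BECPhaseQuadratureSumRule
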